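import Literature.IUT.HodgeArakelov.PlusMinusTowerStableCurveBridgeH25R
import Literature.IUT.HodgeTheaters.StableCurveTemperedDataOfSpecialFibreProp24OfPiData
import Literature.IUT.HodgeTheaters.StableCurveTemperedDataOfSpecialFibreProp24Compact
import Literature.IUT.HodgeTheaters.TemperedCoveringsProp24iiiSub
import HarnessLib

/-!
# [IUTchII] Def. 2.3 (ii)′ → input (A) of Cor. 2.4 (i) (`h25`) AT THE GENUINE [IUTchI] §2 DATUM `ofSpecialFibre X d S …`,
# with [IUTchI] Prop. 2.4 (i)/(iii) SUPPLIED by their producers (proof-only; C-R33 / K4 RE-CLOSE sibling, node `IUTchII:Def2.3(ii)`)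

S. Mochizuki, *Inter-universal Teichmüller theory II*, kurims manuscript (Dec. 2020), §2, Def. 2.3 (ii) p. 68 l. 4–9,
Cor. 2.4 (i) pp. 69–71 [claim: Mochizuki2012, status: disputed] (IUTchII §2 Def 2.3 (ii), kurims p.68; D-0012 claim key —
NOTHING of the series is asserted here); *Inter-universal Teichmüller theory I* (kurims, May 2020) §2, Prop. 2.4 (i)/(iii)
pp. 50–51, Cor. 2.5 p. 51 [claim: Mochizuki2012, status: disputed] (IUTchI §2 Prop 2.4, kurims p.50); [SemiAnbd] §6 p. 69
[cite: MochizukiSemiAnbd2006, Ex 3.10 pp.44-45].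
Cell `abc-iut`, seat abc-iut-w5-d162 (gen 7); R-C letter K / plan C-R33 «K4 RE-CLOSE», row «K4-RECLOSE-L6-IUTchII»
(abc-iut-c312-2 `CONE-K4-RECLOSE.tsv` v3: node `IUTchII:Def2.3(ii)`, class RECLOSABLE; the node's closing theorem
`PlusMinusTower.StableCurveAgreement.h25_piV'_of_def23ii'` (abc-iut-w5-d132, `PlusMinusTowerStableCurveBridgeH25R.lean`)
binds the refuted-closure FACT heads F-2599 `StableCurveTemperedData.Prop24i` (`h24i`) and F-2601 `Prop24iii` (`h24iii`)
of an ABSTRACT [IUTchI] §2 datum `D`; CLOSED producers at the genuine constructor `ofSpecialFibre X d S h36 …`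
(abc-iut-L5-t11): `OfSpecialFibre.prop24i_ofPiData_of_admKer_nhds_one` (abc-iut-w4-d063 / f-lineage,
`StableCurveTemperedDataOfSpecialFibreTowerComplete.lean`), `prop24iii_ofSpecialFibre` («(iii) ⇐ (i) + a cusp», abc-iut-L5-t11),
and — content-free, tempered = profinite — `prop24i/iii_ofSpecialFibre_of_compactSpace` (abc-iut-f-193)).
PROOF-ONLY: no definition, no instance, no new named fact; the original closer and every producer are consumed BY NAME.

WHAT IS PROVED.  For ANY [IUTchII] tower `W` with cuspidal datum `C`, ANY agreement `A` of `(W, C)` with the [IUTchI] §2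
datum `D := StableCurveTemperedData.ofSpecialFibre X d S h36 Σ Σ̂ … Π_ℍ Π̂_ℍ … cuspMeetsH` of a tempered curve `X` with
special-fibre data (abc-iut-L5-t11's genuine constructor; such agreements EXIST at the genuine pair, abc-iut-w5-d132's
`exists_stableCurveAgreement_ofPiCHat_ofSpecialFibre`, not used here), and the repaired Def. 2.3 (ii) statement `Def23_ii'`:
* `h25_piV'_of_def23ii'_ofSpecialFibre_ofPiData` — the node's conclusion («for `I ⊆ Π_v` cuspidal and `γ' ∈ Π̂^±_v ∩ Ker`,
  `I^{γ'} ⊆ Π^±_v ⟹ γ' ∈ Π^±_v`», input (A) of the printed proof of Cor. 2.4 (i)) with `h24i` SUPPLIED by the Π-equivariant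
  special-fibre tower producer (per-level printed inputs `hstf` · `hA3` · `hspec` · `hadm`, verticial/node DATA `Λv`, `E/src/tgt/c₁/c₂`,
  tower DATA `Tw`, `P`), `h24iii` by `prop24iii_ofSpecialFibre` at a cusp `x`, and the per-cusp pro-`Σ` datum `hPx` by
  abc-iut-L5-t11's «`I_x ≅ Ẑ(1)`» (`ofSpecialFibre_nonempty_inertiaTpEquivZHat`) through abc-iut-w5-d121's
  `proSigmaPart_of_equiv_zHat` — ZERO refuted-closure FACT heads among the binders;
* `hPx_ofSpecialFibre` — the per-cusp pro-`Σ` datum is a THEOREM at the genuine constructor (all parameters);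
* `h25_piV'_of_def23ii'_ofSpecialFibre_of_compactSpace` — the same conclusion when `Π^temp_{X_K}` is compact, via the
  content-free producers (`tempered = profinite`; CONSISTENCY evidence only, labelled as such by abc-iut-f-193).
Node-level reading (C-R33): at the genuine carrier `ofSpecialFibre …` the node's closing theorem holds with its two
refuted-closure binders replaced by the producers' printed inputs.

HONEST LIMITS: the tower/agreement data (`W`, `C`, `A`), `Def23_ii'`, the special-fibre DATA of `X` (`S`, `h36`, `Σ ⊆ Σ̂`,
`Π_ℍ`, `Π̂_ℍ`, `cuspMeetsH`) and the producers' per-level inputs stay HYPOTHESES/DATA exactly as their authors typed them;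
no curve is asserted to carry them (non-vacuity of the producer package: abc-iut-f-193's `exists_ofSpecialFibre_input_prop24`);
re-closed-at-a-carrier ≠ proved-in-print; no side is taken on [IUTchIII] Cor. 3.12; typed ≠ proved; nothing here says abc
is proved or refuted.
-/

noncomputable section

namespace Literature.IUT.HodgeArakelov

open Literature.IUT.HodgeTheaters Literature.AnabelianGeometry.SemiGraphs
open Literature.AnabelianGeometry.SemiGraphs.ProfiniteSemiGraph
open Literature.IUT.HodgeTheaters.StableCurveTemperedData
open _root_.Topology
open scoped Pointwise

namespace PlusMinusTower

namespace StableCurveAgreement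

variable {S : BadPlaceSetting.{0}} {P : TopGroup.{0}} {T : TemperedCoverings S P} {W : PlusMinusTower T}
  {C : CuspidalInertiaData W}
  {p : ℕ} [Fact p.Prime] {X : TemperedCurve p} {d : X.GroupLevelData}
  {Sf : SpecialFibreData (X.toTemperedArithmeticGroup d)} {h36 : Sf.Gc.Prop36Hypotheses}
  {Sigma SigmaHat : Set ℕ} {hsub : Sigma ⊆ SigmaHat} {hne : Sigma.Nonempty}
  {hprime : ∀ q ∈ SigmaHat, q.Prime} {hp : p ∉ Sigma} {TpH : Subgroup Sf.chart.G}
  {HatH : Subgroup (TemperedGraphGroupData.exists_completion_of_prop36 Sf.Gc h36 Sf.chart).choose}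
  {hle : TpH.map (TemperedGraphGroupData.exists_completion_of_prop36 Sf.Gc h36
    Sf.chart).choose_spec.choose.toMonoidHom ≤ HatH}
  {cMH : {x : X.Pt // X.IsCusp x} → Prop}

/-- **The per-cusp pro-`Σ` datum `hPx` of the Cor. 2.4 (i) bridge is a THEOREM at the genuine [IUTchI] §2 constructor**
(every cusp inertia group `I_x ⊆ Δ^tp_X` of `ofSpecialFibre X d S …` contains an infinite compact totally disconnected
pro-`Σ` subgroup): abc-iut-w5-d121's `proSigmaPart_of_equiv_zHat` fed with abc-iut-L5-t11's «`I_x ≅ Ẑ(1)`» at the datum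
(`ofSpecialFibre_nonempty_inertiaTpEquivZHat`, the [SemiAnbd] §6 field read at the datum).
[claim: Mochizuki2012, status: disputed] (IUTchI §2 Cor 2.5, kurims p.51) [cite: MochizukiSemiAnbd2006, Ex 3.10 pp.44-45] -/
theorem hPx_ofSpecialFibre :
    ∀ x : (StableCurveTemperedData.ofSpecialFibre X d Sf h36 Sigma SigmaHat hsub hne hprime hp TpH HatH hle cMH).Cusp,
      ∃ Q : Subgroup (StableCurveTemperedData.ofSpecialFibre X d Sf h36 Sigma SigmaHat hsub hne hprime hp TpH HatH hle cMH).DeltaTp,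
        Q ≤ (StableCurveTemperedData.ofSpecialFibre X d Sf h36 Sigma SigmaHat hsub hne hprime hp TpH HatH hle cMH).inertiaTp x ∧
        IsCompact (Q : Set (StableCurveTemperedData.ofSpecialFibre X d Sf h36 Sigma SigmaHat hsub hne hprime hp TpH HatH hle
          cMH).DeltaTp) ∧
        (Q : Set (StableCurveTemperedData.ofSpecialFibre X d Sf h36 Sigma SigmaHat hsub hne hprime hp TpH HatH hle
          cMH).DeltaTp).Infinite ∧
        IsProSigma (StableCurveTemperedData.ofSpecialFibre X d Sf h36 Sigma SigmaHat hsub hne hprime hp TpH HatH hle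
          cMH).graph.Sigma Q ∧ TotallyDisconnectedSpace Q :=
  (StableCurveTemperedData.ofSpecialFibre X d Sf h36 Sigma SigmaHat hsub hne hprime hp TpH HatH hle cMH).proSigmaPart_of_equiv_zHat
    fun x => (StableCurveTemperedData.ofSpecialFibre_nonempty_inertiaTpEquivZHat X d Sf h36 Sigma SigmaHat hsub hne
      hprime hp TpH HatH hle cMH x).some

/-- **IUTchII:Def2.3(ii)′ ⟶ input (A) of Cor. 2.4 (i) (`h25`) AT THE GENUINE DATUM `ofSpecialFibre X d S …`, with [IUTchI]
Prop. 2.4 (i) and (iii) SUPPLIED** — the K4 RE-CLOSE sibling of abc-iut-w5-d132's `h25_piV'_of_def23ii'`: for any agreement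
`A` of `(W, C)` with the genuine [IUTchI] §2 datum and the repaired statement `Def23_ii' C Π_v Π^±_v`, every `Π_v`-cuspidal
`I` satisfies «`γ' ∈ Π̂^±_v ∩ Ker(↠ G_v)`, `I^{γ'} ⊆ Π^±_v ⟹ γ' ∈ Π^±_v`».  The refuted-closure binders of the closer are
DISCHARGED at the carrier: `h24i` by `OfSpecialFibre.prop24i_ofPiData_of_admKer_nhds_one` (Π-equivariant special-fibre tower
`Tw` with structure `Pw`, per-level printed inputs `hstf` · `hA3` · `hspec` · `hadm`, verticial/node DATA), `h24iii` by
abc-iut-L5-t11's `prop24iii_ofSpecialFibre` at the cusp `x`, `hPx` by `hPx_ofSpecialFibre`; `Π^tp_X` Hausdorff is the curve's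
own instance.  ZERO refuted-closure FACT heads remain. [claim: Mochizuki2012, status: disputed] (IUTchII §2 Def 2.3 (ii), kurims p.68) -/
theorem h25_piV'_of_def23ii'_ofSpecialFibre_ofPiData
    (A : StableCurveAgreement W C
      (StableCurveTemperedData.ofSpecialFibre X d Sf h36 Sigma SigmaHat hsub hne hprime hp TpH HatH hle cMH))
    (hrel' : Def23_ii' C W.piV W.piPM)
    (Tw : SpecialFibreTower X.DeltaTemp) (Pw : SpecialFibreTower.PiData X d Sf Tw) (x : {x : X.Pt // X.IsCusp x})
    (hstf : (StableCurveTemperedData.ofSpecialFibre X d Sf h36 Sigma SigmaHat hsub hne hprime hp TpH HatH hle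
      cMH).StronglyTorsionFreeSigma)
    (Λv : ∀ i, (Tw.Gc i).graph.Vertex → Subgroup (Tw.chart i).G)
    (hΛv : ∀ i v, Λv i v ∈ verticialSubgroups (Tw.chart i) v)
    (E : ℕ → Type) (src tgt : ∀ i, E i → (Tw.Gc i).graph.Vertex) (c₁ c₂ : ∀ i, E i → (Tw.chart i).G)
    (hA3 : ∀ i (v w : (Tw.Gc i).graph.Vertex) (g h : (OfSpecialFibre.levelGraph X Tw Sigma SigmaHat hsub hne hprime i).Hat),
      MulAut.conj g • (Λv i v).map (OfSpecialFibre.levelGraph X Tw Sigma SigmaHat hsub hne hprime i).ι ⊓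
          MulAut.conj h • (Λv i w).map (OfSpecialFibre.levelGraph X Tw Sigma SigmaHat hsub hne hprime i).ι ≠ ⊥ →
        (v = w ∧ g⁻¹ * h ∈ (Λv i v).map (OfSpecialFibre.levelGraph X Tw Sigma SigmaHat hsub hne hprime i).ι) ∨
        ∃ (e : E i) (k : (OfSpecialFibre.levelGraph X Tw Sigma SigmaHat hsub hne hprime i).Hat),
          ∃ p ∈ (Λv i (src i e)).map (OfSpecialFibre.levelGraph X Tw Sigma SigmaHat hsub hne hprime i).ι,
          ∃ q ∈ (Λv i (tgt i e)).map (OfSpecialFibre.levelGraph X Tw Sigma SigmaHat hsub hne hprime i).ι,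
            (src i e = v ∧ tgt i e = w ∧
                g = k * (OfSpecialFibre.levelGraph X Tw Sigma SigmaHat hsub hne hprime i).ι (c₁ i e) * p ∧
                h = k * (OfSpecialFibre.levelGraph X Tw Sigma SigmaHat hsub hne hprime i).ι (c₂ i e) * q) ∨
            (src i e = w ∧ tgt i e = v ∧
                h = k * (OfSpecialFibre.levelGraph X Tw Sigma SigmaHat hsub hne hprime i).ι (c₁ i e) * p ∧
                g = k * (OfSpecialFibre.levelGraph X Tw Sigma SigmaHat hsub hne hprime i).ι (c₂ i e) * q))
    (hspec : (OfSpecialFibre.towerOfSpecialFibreTower X d Tw Sigma SigmaHat hsub hne hprime Sf h36 hp TpH HatH hle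
      cMH).SpecializationAb)
    (hadm : ∀ U ∈ 𝓝 (1 : ↥X.DeltaTemp), ∃ j, ((Tw.admKer j : Subgroup ↥X.DeltaTemp) : Set ↥X.DeltaTemp) ⊆ U)
    {I : Subgroup W.Corhat} (hI : C.IsCuspidalInertia W.piV I) :
    ∀ γ' : W.Corhat, γ' ∈ W.pmHat ⊓ W.aug.ker →
      I.map (MulAut.conj γ').toMonoidHom ≤ W.piPM → γ' ∈ W.piPM := by
  -- `Π^tp_X = Π^temp_{X_K}` is Hausdorff (abc-iut-L5-t11's `t2Space_piTemp`; `(ofSpecialFibre …).PiTp` is `X.PiTemp`)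
  haveI : T2Space (StableCurveTemperedData.ofSpecialFibre X d Sf h36 Sigma SigmaHat hsub hne hprime hp TpH HatH hle
      cMH).PiTp := StableCurveTemperedData.t2Space_piTemp X
  have h24i : (StableCurveTemperedData.ofSpecialFibre X d Sf h36 Sigma SigmaHat hsub hne hprime hp TpH HatH hle cMH).Prop24i :=
    OfSpecialFibre.prop24i_ofPiData_of_admKer_nhds_one X d Tw Sigma SigmaHat hsub hne hprime Sf h36 hp TpH HatH hle cMH Pw
      hstf Λv hΛv E src tgt c₁ c₂ hA3 hspec hadm
  exact A.h25_piV'_of_def23ii' h24i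
    (StableCurveTemperedData.prop24iii_ofSpecialFibre X d Sf h36 Sigma SigmaHat hsub hne hprime hp TpH HatH hle cMH x h24i)
    hrel' hPx_ofSpecialFibre hI

/-- **The same conclusion when `Π^temp_{X_K}` is compact — content-free route** (abc-iut-f-193's
`prop24i/iii_ofSpecialFibre_of_compactSpace`: at compact `Π^temp` «tempered = profinite» and Prop. 2.4 is CONTENT-FREE;
CONSISTENCY evidence for the typed instance forms only, recorded because the K-census lists these producers as CLOSED).
[claim: Mochizuki2012, status: disputed] (IUTchII §2 Def 2.3 (ii), kurims p.68) -/
theorem h25_piV'_of_def23ii'_ofSpecialFibre_of_compactSpace [CompactSpace X.PiTemp]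
    (A : StableCurveAgreement W C
      (StableCurveTemperedData.ofSpecialFibre X d Sf h36 Sigma SigmaHat hsub hne hprime hp TpH HatH hle cMH))
    (hrel' : Def23_ii' C W.piV W.piPM) {I : Subgroup W.Corhat} (hI : C.IsCuspidalInertia W.piV I) :
    ∀ γ' : W.Corhat, γ' ∈ W.pmHat ⊓ W.aug.ker →
      I.map (MulAut.conj γ').toMonoidHom ≤ W.piPM → γ' ∈ W.piPM := by
  haveI : T2Space (StableCurveTemperedData.ofSpecialFibre X d Sf h36 Sigma SigmaHat hsub hne hprime hp TpH HatH hle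
      cMH).PiTp := StableCurveTemperedData.t2Space_piTemp X
  exact A.h25_piV'_of_def23ii'
    (OfSpecialFibre.prop24i_ofSpecialFibre_of_compactSpace X d Sf h36 Sigma SigmaHat hsub hne hprime hp TpH HatH hle cMH)
    (OfSpecialFibre.prop24iii_ofSpecialFibre_of_compactSpace X d Sf h36 Sigma SigmaHat hsub hne hprime hp TpH HatH hle cMH)
    hrel' hPx_ofSpecialFibre hI

end StableCurveAgreement

end PlusMinusTower

end Literature.IUT.HodgeArakelov

end
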